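import Summits.Ventures.HodgeRepro2.T5NonSplitPlaceUnitaryGroup
import Summits.Ventures.HodgeRepro2.T5AdicCompletionIntegersSpan
import Summits.Ventures.HodgeRepro2.T5UnitaryHeckeAdjoint

/-!
# The tensor lattice at a non-split place and the record's `K_v` (cell pub-hodge-repro2, seat p3)

Tier-5 N3 support — the integral points of files 224–226 on the TENSOR side. The record's local algebra at a
finite place `v` of `K⁺` is `K⁺_v ⊗ K` (conjugation `1 ⊗ c`); its integral structure is «`𝒪_{K⁺_v} ⊗ 𝒪_K`», here
the `𝒪_{K⁺_v}`-combinations `Λ = {∑ aᵢ ⊗ lᵢ : aᵢ ∈ 𝒪_{K⁺_v}}` of `𝓞_{K⁺}`-generators `l₁, …, l_r` of `𝓞_K`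
(`tensorLattice`). At a NON-SPLIT place:
* `nonSplitEquiv_tmul` — `a ⊗ x ↦ a · x` in `K_w` (seat p4's structure map);
* **`image_tensorLattice`** — `nonSplitEquiv '' Λ = 𝒪_w` (file 227: the local integers are generated by the
  global ones);
* `tensorStdLattice` — `Λ^n ⊂ (K⁺_v ⊗ K)^n`, with `image_tensorStdLattice : (e ∘ ·) '' Λ^n = 𝒪_w^n`
  (seat p8's `stdLattice`);
* **`image_tensorStdLattice_eq_iff_mem_hyperspecialSubgroup`** — an isometry `g` of `1 ⊗ H` stabilises `Λ^n`
  iff `recordNonSplitEquiv' g` lies in seat p8's `hyperspecialSubgroup 𝒪_w H_w` (T5-128's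
  `mem_hyperspecialSubgroup_iff_image_stdLattice`): THE RECORD'S `K_v` (the stabiliser of the tensor lattice) IS
  p8's `K_v` under the identification of file 226.
With files 224–227 the identification of the record's `(U(V_v), K_v)` with p8's `(U(H_w), K_w)` at a non-split
place is complete, on the route's own objects, for every CM datum `(y, θ)` and every `𝓞_{K⁺}`-generating family
of `𝓞_K`. The split-place counterpart (`Λ ↦ 𝒪_w × 𝒪_w` through `splitEquiv`) is the next file's.

Mathlib + this seat's files 226 / 227 + seat p8's T5-128 / T5-13x (T5UnitaryHeckeAdjoint) and their imports;
no display; no device. §8(d): uses an L-value-free non-vanishing device: NO.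
-/

namespace Summit.Ventures.HodgeRepro2.T5TensorLatticeNonSplit

open Matrix NumberField NumberField.IsCMField IsDedekindDomain IsDedekindDomain.HeightOneSpectrum Module
open scoped TensorProduct
open Summit.Ventures.HodgeRepro2.T5UnitaryGroupForm Summit.Ventures.HodgeRepro2.T5UnitaryGroupIsometry
  Summit.Ventures.HodgeRepro2.T5UnitaryHeckeAdjoint Summit.Ventures.HodgeRepro2.T5SplitPlaceUnitaryGroup
  Summit.Ventures.HodgeRepro2.T5NonSplitPlaceUnitaryGroup Summit.Ventures.HodgeRepro2.T5AdicCompletionIntegersSpan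
  Summit.Ventures.HodgeRepro2.T5FinitePlaceTensorEquiv Summit.Ventures.HodgeRepro2.T5FinitePlaceCM
  Summit.Ventures.HodgeRepro2.T5FinitePlaceNormIndex Summit.Ventures.HodgeRepro2.T5StarOfInvolution
  Summit.Ventures.HodgeRepro2.T5FinitePlaceSplitClassification

section Lattice

variable (K : Type*) [Field K] [NumberField K] [IsCMField K]
variable (v : HeightOneSpectrum (𝓞 (maximalRealSubfield K))) (w : HeightOneSpectrum (𝓞 K))
  [w.asIdeal.LiesOver v.asIdeal]
variable {θ : maximalRealSubfield K} {y : K}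
  (hθ : algebraMap (maximalRealSubfield K) K θ = y ^ 2) (hy : complexConj K y ≠ y)
  (hsq : ¬ IsSquare (algebraMap (maximalRealSubfield K) (v.adicCompletion (maximalRealSubfield K)) θ))
variable {r : ℕ} (l : Fin r → 𝓞 K)

/-- **The tensor lattice**: the `𝒪_{K⁺_v}`-combinations `∑ aᵢ ⊗ lᵢ` of a family `l` of elements of `𝓞_K`, inside
the record's local algebra `K⁺_v ⊗ K`. -/
def tensorLattice : Set ((v.adicCompletion (maximalRealSubfield K)) ⊗[maximalRealSubfield K] K) :=
  {z | ∃ a : Fin r → v.adicCompletionIntegers (maximalRealSubfield K),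
    z = ∑ i, ((a i : v.adicCompletion (maximalRealSubfield K)) ⊗ₜ algebraMap (𝓞 K) K (l i))}

/-- `nonSplitEquiv (a ⊗ x) = a · x` in `K_w` (seat p4's structure map `K⁺_v → K_w`). -/
theorem nonSplitEquiv_tmul (a : v.adicCompletion (maximalRealSubfield K)) (x : K) :
    nonSplitEquiv K v w hθ hy hsq (a ⊗ₜ x) =
      algebraMap (v.adicCompletion (maximalRealSubfield K)) (w.adicCompletion K) a *
        algebraMap K (w.adicCompletion K) x := by
  have h1 : a ⊗ₜ[maximalRealSubfield K] x =
      algebraMap (v.adicCompletion (maximalRealSubfield K))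
        ((v.adicCompletion (maximalRealSubfield K)) ⊗[maximalRealSubfield K] K) a * (1 ⊗ₜ x) := by
    rw [Algebra.TensorProduct.algebraMap_apply, Algebra.algebraMap_self_apply, Algebra.TensorProduct.tmul_mul_tmul,
      mul_one, one_mul]
  rw [h1, map_mul]
  congr 1
  · exact T5FinitePlaceTensorClassification.tensorLiftEquiv_algebraMap K v w hθ.symm (span_pair_eq_top K hy) hsq a
  · rw [nonSplitEquiv_apply, tensorLiftEquivOfNotIsSquare,
      algebraMap_eq_tensorLiftEquiv_one_tmul v w (finrank_eq_of_not_isSquare v w hθ.symm (span_pair_eq_top K hy) hsq)]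

/-- `nonSplitEquiv` on a combination `∑ aᵢ ⊗ lᵢ`. -/
theorem nonSplitEquiv_sum (a : Fin r → v.adicCompletion (maximalRealSubfield K)) :
    nonSplitEquiv K v w hθ hy hsq (∑ i, a i ⊗ₜ algebraMap (𝓞 K) K (l i)) =
      ∑ i, algebraMap (v.adicCompletion (maximalRealSubfield K)) (w.adicCompletion K) (a i) *
        intoCompletion w (l i) := by
  rw [map_sum]
  exact Finset.sum_congr rfl fun i _ => nonSplitEquiv_tmul K v w hθ hy hsq (a i) _

/-- **The image of the tensor lattice is `𝒪_w`** for a `𝓞_{K⁺}`-generating family of `𝓞_K` (file 227). -/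
theorem image_tensorLattice (hl : Submodule.span (𝓞 (maximalRealSubfield K)) (Set.range l) = ⊤) :
    nonSplitEquiv K v w hθ hy hsq '' tensorLattice K v l =
      (w.adicCompletionIntegers K : Set (w.adicCompletion K)) := by
  rw [← setOf_exists_sum_smul_eq v w l hl]
  ext x
  constructor
  · rintro ⟨z, ⟨a, rfl⟩, rfl⟩
    refine ⟨a, ?_⟩
    rw [nonSplitEquiv_sum]
    exact Finset.sum_congr rfl fun i _ => (Algebra.smul_def _ _).symm
  · rintro ⟨a, rfl⟩
    refine ⟨∑ i, ((a i : v.adicCompletion (maximalRealSubfield K)) ⊗ₜ algebraMap (𝓞 K) K (l i)), ⟨a, rfl⟩, ?_⟩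
    rw [nonSplitEquiv_sum]
    exact Finset.sum_congr rfl fun i _ => (Algebra.smul_def _ _).symm

variable {n : Type*} [Fintype n] [DecidableEq n]

/-- `Λ^n`: the vectors with entries in the tensor lattice. -/
def tensorStdLattice : Set (n → (v.adicCompletion (maximalRealSubfield K)) ⊗[maximalRealSubfield K] K) :=
  {x | ∀ i, x i ∈ tensorLattice K v l}

omit [Fintype n] [DecidableEq n] in
/-- `(e ∘ ·) '' Λ^n = 𝒪_w^n` (seat p8's `stdLattice`). -/
theorem image_tensorStdLattice (hl : Submodule.span (𝓞 (maximalRealSubfield K)) (Set.range l) = ⊤) :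
    (fun x : n → (v.adicCompletion (maximalRealSubfield K)) ⊗[maximalRealSubfield K] K =>
        nonSplitEquiv K v w hθ hy hsq ∘ x) '' tensorStdLattice K v l (n := n) =
      stdLattice (w.adicCompletionIntegers K) := by
  ext y
  constructor
  · rintro ⟨x, hx, rfl⟩
    rw [mem_stdLattice_iff]
    intro i
    have : nonSplitEquiv K v w hθ hy hsq (x i) ∈ (w.adicCompletionIntegers K : Set (w.adicCompletion K)) := by
      rw [← image_tensorLattice K v w hθ hy hsq l hl]
      exact ⟨x i, hx i, rfl⟩
    exact ⟨⟨_, this⟩, rfl⟩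
  · intro hy'
    rw [mem_stdLattice_iff] at hy'
    have : ∀ i, ∃ z ∈ tensorLattice K v l, nonSplitEquiv K v w hθ hy hsq z = y i := by
      intro i
      obtain ⟨s, hs⟩ := hy' i
      have hmem : y i ∈ (w.adicCompletionIntegers K : Set (w.adicCompletion K)) := by rw [← hs]; exact s.2
      rw [← image_tensorLattice K v w hθ hy hsq l hl] at hmem
      exact hmem
    choose x hx hxy using this
    exact ⟨x, hx, funext hxy⟩

end Lattice

/-! ## The record's `K_v` is seat p8's `K_v` -/

section Stabilizer

variable (K : Type*) [Field K] [NumberField K] [IsCMField K]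
variable (v : HeightOneSpectrum (𝓞 (maximalRealSubfield K))) (w : HeightOneSpectrum (𝓞 K))
  [w.asIdeal.LiesOver v.asIdeal]
variable {θ : maximalRealSubfield K} {y : K}
  (hθ : algebraMap (maximalRealSubfield K) K θ = y ^ 2) (hy : complexConj K y ≠ y)
  (hsq : ¬ IsSquare (algebraMap (maximalRealSubfield K) (v.adicCompletion (maximalRealSubfield K)) θ))
variable {r : ℕ} (l : Fin r → 𝓞 K) {n : Type*} [Fintype n] [DecidableEq n]

omit [IsCMField K] [w.asIdeal.LiesOver v.asIdeal] [DecidableEq n] in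
/-- The action of `g` on vectors commutes with the entrywise ring isomorphism. -/
theorem comp_mulVec (e : ((v.adicCompletion (maximalRealSubfield K)) ⊗[maximalRealSubfield K] K) ≃+*
      w.adicCompletion K)
    (M : Matrix n n ((v.adicCompletion (maximalRealSubfield K)) ⊗[maximalRealSubfield K] K))
    (x : n → (v.adicCompletion (maximalRealSubfield K)) ⊗[maximalRealSubfield K] K) :
    e ∘ M.mulVec x = (M.map e).mulVec (e ∘ x) := by
  funext i
  simp only [Function.comp_apply, Matrix.mulVec, dotProduct, map_sum, map_mul, Matrix.map_apply]

/-- **THE RECORD'S `K_v` IS SEAT p8's `K_v`**: an isometry `g` of `1 ⊗ H` stabilises the tensor lattice `Λ^n` iff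
its image under `recordNonSplitEquiv'` lies in seat p8's `hyperspecialSubgroup 𝒪_w H_w`. -/
theorem image_tensorStdLattice_eq_iff_mem_hyperspecialSubgroup
    (hl : Submodule.span (𝓞 (maximalRealSubfield K)) (Set.range l) = ⊤) (H : Matrix n n K)
    (g : (letI := tensorStarRing K v; ↥(formUnitaryGroup (tensorGram K v H)))) :
    (fun x : n → (v.adicCompletion (maximalRealSubfield K)) ⊗[maximalRealSubfield K] K =>
        (g.1 : Matrix n n _).mulVec x) '' tensorStdLattice K v l (n := n) = tensorStdLattice K v l ↔
      (letI := starRingOfQuadratic (finrank_eq_two K v w hθ hy hsq)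
          (localConj v w hθ.symm (span_pair_eq_top K hy) hsq (complexConj K))
          (localConj_ne_one v w hθ.symm (span_pair_eq_top K hy) hsq (complexConj K)
            (complexConj_apply_eq_neg K hθ hy));
        recordNonSplitEquiv' K v w hθ hy hsq H g ∈
          hyperspecialSubgroup (w.adicCompletionIntegers K) (H.map (algebraMap K (w.adicCompletion K)))) := by
  letI := tensorStarRing K v
  letI := starRingOfQuadratic (finrank_eq_two K v w hθ hy hsq)
    (localConj v w hθ.symm (span_pair_eq_top K hy) hsq (complexConj K))
    (localConj_ne_one v w hθ.symm (span_pair_eq_top K hy) hsq (complexConj K)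
      (complexConj_apply_eq_neg K hθ hy))
  rw [mem_hyperspecialSubgroup_iff_image_stdLattice]
  set e := nonSplitEquiv K v w hθ hy hsq with he
  -- the matrix of `recordNonSplitEquiv' g` is `g.map e`
  have hmat : (((recordNonSplitEquiv' K v w hθ hy hsq H g).1 : GL n (w.adicCompletion K)) :
      Matrix n n (w.adicCompletion K)) = (g.1 : Matrix n n _).map e := rfl
  -- transport the image along the bijection `F : x ↦ e ∘ x`
  set F : (n → (v.adicCompletion (maximalRealSubfield K)) ⊗[maximalRealSubfield K] K) → (n → w.adicCompletion K) :=
    fun x => e ∘ x with hF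
  have hinj : Function.Injective F := fun x x' h => funext fun i => e.injective (congrFun h i)
  have key : ∀ S : Set (n → (v.adicCompletion (maximalRealSubfield K)) ⊗[maximalRealSubfield K] K),
      F '' ((fun x => (g.1 : Matrix n n _).mulVec x) '' S) =
        (fun y => ((g.1 : Matrix n n _).map e).mulVec y) '' (F '' S) := by
    intro S
    rw [Set.image_image, Set.image_image]
    exact congrArg (· '' S) (funext fun x => comp_mulVec K v w e _ x)
  have hL : F '' tensorStdLattice K v l = stdLattice (w.adicCompletionIntegers K) :=
    image_tensorStdLattice K v w hθ hy hsq l hl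
  rw [hmat, ← hL, ← key]
  exact hinj.image_injective.eq_iff.symm

end Stabilizer

end Summit.Ventures.HodgeRepro2.T5TensorLatticeNonSplit
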